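import Literature.Analysis.Complex.PQExhaustionZero
import Literature.Geometry.Kaehler.PoincareLemmaStarConvex
import Mathlib.LinearAlgebra.Multilinear.FiniteDimensional
import Mathlib.Topology.MetricSpace.Thickening
import Mathlib.Topology.Algebra.Module.FiniteDimension
import HarnessLib

/-!
# `∂̄`-potentials on an open set exhausted by compacts with the Cousin property (Hörmander, Thm. 2.7.8)

The abstract form of Hörmander's Theorem 2.7.8 in the flat `(p,q)`-calculus of
`Literature/Analysis/Complex/PQTypes.lean`, `PQExtDeriv.lean` (forms `ℂ^ι → Λ^k`, pointwise types
`IsOfTypeAt`, projections `typeProjAt`, Mathlib's `extDeriv`), generalising the concentric-polydisc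
exhaustions of `Literature/Analysis/Complex/PQExhaustion.lean` and `PQExhaustionZero.lean`:

Let `Ω ⊆ ℂ^ι` be open and `K₀ ⊆ K₁ ⊆ ⋯` compact subsets with `K_j ⊆ interior K_{j+1}` and
`Ω = ⋃ K_j`, such that every `K_j` has the **Cousin property** (Hörmander (1973), p. 56: for all
`∂̄`-closed `C^∞` data of type `(p,q+1)` on a neighbourhood of `K_j` the equation `∂̄u = f` has a
`C^∞` solution of type `(p,q)` in a neighbourhood of `K_j`; hypothesis `hC`, spelled out).

* `exists_dbar_potential_of_compactExhaustion_succ` — data of type `(p,q+2)`: there is a potential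
  on all of `Ω` (Hörmander's case `q > 0`: correct the local potentials by `∂̄`-exact terms so
  that they are eventually constant near each `K_j`);
* `exists_dbar_potential_of_compactExhaustion_zero` — data of type `(p,1)`, assuming moreover that
  functions holomorphic near `K_j` are uniform limits on `K_j` of entire functions (hypothesis
  `hA`; Hörmander's Thm. 2.7.7): the holomorphic corrections are approximated by entire maps with
  control of `j` derivatives on `K_j` (Cauchy estimates), and the potential is a `C^∞`-convergent
  series (Hörmander's case `q = 0`);
* `exists_dbar_potential_of_compactExhaustion` — both cases (with `n = p + q` this is exactly the
  "flat solver on `Ω`" consumed by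
  `Literature.Analysis.Complex.subsingleton_dolbeaultCohomology_of_flatDbarSolver`).

Auxiliary: `Λ^k(V; G)` is finite-dimensional (`moduleFinite_continuousAlternatingMap`), entire
approximation of vector-valued holomorphic maps from the scalar case
(`exists_entire_approx_of_scalar`), and the correction step with derivative control
(`exists_entire_correction_of_approx`, cf. `exists_entire_correction`).

## References

* L. Hörmander, *An Introduction to Complex Analysis in Several Variables*, 2nd ed. (1973),
  Thm. 2.7.8 and its proof (p. 58–59), Thm. 2.2.7 (Cauchy estimates). [HormanderSCV1973]
-/

noncomputable section

open scoped ComplexConjugate ContDiff Topology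
open Complex Function ContinuousAlternatingMap Set Filter Metric
open Literature.LinearAlgebra.Alternating

namespace Literature.Analysis.Complex

variable {ι : Type*} [Fintype ι] [DecidableEq ι]

/-! ### Finite-dimensionality of `Λ^k` and vector-valued entire approximation -/

section FiniteDim

variable {V : Type*} [NormedAddCommGroup V] [NormedSpace ℝ V] [FiniteDimensional ℝ V]
  {G : Type*} [NormedAddCommGroup G] [NormedSpace ℝ G] [FiniteDimensional ℝ G]

omit [Fintype ι] [DecidableEq ι] in
/-- Continuous alternating maps between finite-dimensional real normed spaces form a
finite-dimensional space (they embed into the multilinear maps). [folklore] -/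
theorem moduleFinite_continuousAlternatingMap (k : ℕ) : Module.Finite ℝ (V [⋀^Fin k]→L[ℝ] G) := by
  let L : (V [⋀^Fin k]→L[ℝ] G) →ₗ[ℝ] MultilinearMap ℝ (fun _ : Fin k => V) G :=
    { toFun := fun f => f.toContinuousMultilinearMap.toMultilinearMap
      map_add' := fun _ _ => rfl
      map_smul' := fun _ _ => rfl }
  have hL : Function.Injective L := fun f g h =>
    ContinuousAlternatingMap.ext fun v => (DFunLike.congr_fun h v : _)
  exact Module.Finite.of_injective L hL

end FiniteDim

omit [DecidableEq ι] in
/-- The space `Λ^n(ℂ^ι)` of complex-valued real-alternating forms is finite-dimensional over `ℂ`.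
[folklore] -/
theorem finiteDimensional_complex_forms (n : ℕ) :
    FiniteDimensional ℂ ((ι → ℂ) [⋀^Fin n]→L[ℝ] ℂ) := by
  haveI : Module.Finite ℝ ((ι → ℂ) [⋀^Fin n]→L[ℝ] ℂ) := moduleFinite_continuousAlternatingMap n
  exact Module.Finite.of_restrictScalars_finite ℝ ℂ _

omit [DecidableEq ι] in
/-- **Entire approximation of vector-valued holomorphic maps from the scalar case**: if every
function holomorphic on `W` can be approximated uniformly on `A` by entire functions, then so can
every holomorphic map `W → Λ` into a finite-dimensional complex normed space (approximate the
coordinates in a basis). [folklore] -/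
theorem exists_entire_approx_of_scalar {Λ : Type*} [NormedAddCommGroup Λ] [NormedSpace ℂ Λ]
    [FiniteDimensional ℂ Λ] {A W : Set (ι → ℂ)}
    (hA : ∀ {h : (ι → ℂ) → ℂ}, DifferentiableOn ℂ h W →
      ∀ ε > 0, ∃ g : (ι → ℂ) → ℂ, Differentiable ℂ g ∧ ∀ x ∈ A, ‖h x - g x‖ ≤ ε)
    {δ : (ι → ℂ) → Λ} (hδ : DifferentiableOn ℂ δ W) {ε : ℝ} (hε : 0 < ε) :
    ∃ g : (ι → ℂ) → Λ, Differentiable ℂ g ∧ ∀ x ∈ A, ‖δ x - g x‖ ≤ ε := by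
  set b := Module.finBasis ℂ Λ with hb
  -- the coordinate functions are holomorphic on `W`
  have hcoord : ∀ i, DifferentiableOn ℂ (fun x => b.coord i (δ x)) W := fun i =>
    (LinearMap.toContinuousLinearMap (b.coord i)).differentiable.comp_differentiableOn hδ
  set S : ℝ := ∑ i, ‖b i‖ + 1 with hS
  have hS0 : 0 < S := by
    have : 0 ≤ ∑ i, ‖b i‖ := Finset.sum_nonneg fun i _ => norm_nonneg _
    linarith
  have hη : 0 < ε / S := div_pos hε hS0
  choose g hg hga using fun i => hA (hcoord i) (ε / S) hη
  refine ⟨fun x => ∑ i, g i x • b i, ?_, fun x hx => ?_⟩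
  · exact Differentiable.fun_sum fun i _ => (hg i).smul_const (b i)
  · have hrepr : δ x - ∑ i, g i x • b i = ∑ i, (b.coord i (δ x) - g i x) • b i := by
      conv_lhs => rw [← b.sum_repr (δ x)]
      simp only [sub_smul, Finset.sum_sub_distrib]
      rfl
    rw [hrepr]
    calc ‖∑ i, (b.coord i (δ x) - g i x) • b i‖
        ≤ ∑ i, ‖(b.coord i (δ x) - g i x) • b i‖ := norm_sum_le _ _
      _ ≤ ∑ i, ε / S * ‖b i‖ := Finset.sum_le_sum fun i _ => by
          rw [norm_smul]
          exact mul_le_mul_of_nonneg_right (hga i x hx) (norm_nonneg _)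
      _ = ε / S * ∑ i, ‖b i‖ := by rw [Finset.mul_sum]
      _ ≤ ε / S * S := by
          gcongr
          linarith
      _ = ε := div_mul_cancel₀ ε hS0.ne'

/-! ### The correction step with derivative control (Cauchy estimates) -/

omit [DecidableEq ι] in
/-- **Entire correction to any order on a compact set** (cf. `exists_entire_correction`): let
`δ : ℂ^ι → Λ^n` be holomorphic on the open set `W` and fixed by the `(p,0)`-projection, and suppose
every ball `closedBall x κ`, `x ∈ K₀`, lies in `W ∩ A` where on `A` the map `δ` can be uniformly
approximated by entire maps. Then for all `N`, `ε > 0` there is an entire `g` such that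
`u = δ - (g)^{p,0}` has `‖Dʲu‖ ≤ ε` on `K₀` for `j ≤ N` (uniform approximation on `A`, then the
Cauchy estimates on the balls of radius `κ`). [cite: HormanderSCV1973, Thm. 2.2.7] -/
theorem exists_entire_correction_of_approx {n p : ℕ} {δ : (ι → ℂ) → (ι → ℂ) [⋀^Fin n]→L[ℝ] ℂ}
    {W A K₀ : Set (ι → ℂ)} (hW : IsOpen W) (hδ : DifferentiableOn ℂ δ W)
    (hδt : ∀ x, typeProjAt p 0 (δ x) = δ x) {κ : ℝ} (hκ : 0 < κ)
    (hballs : ∀ x ∈ K₀, closedBall x κ ⊆ W ∩ A)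
    (happrox : ∀ ε > 0, ∃ g : (ι → ℂ) → (ι → ℂ) [⋀^Fin n]→L[ℝ] ℂ, Differentiable ℂ g ∧
      ∀ y ∈ A, ‖δ y - g y‖ ≤ ε)
    (N : ℕ) {ε : ℝ} (hε : 0 < ε) :
    ∃ g : (ι → ℂ) → (ι → ℂ) [⋀^Fin n]→L[ℝ] ℂ, Differentiable ℂ g ∧
      ∀ j ≤ N, ∀ x ∈ K₀, ‖iteratedFDeriv ℝ j (fun y => δ y - typeProjAt p 0 (g y)) x‖ ≤ ε := by
  set P : ((ι → ℂ) [⋀^Fin n]→L[ℝ] ℂ) →L[ℂ] ((ι → ℂ) [⋀^Fin n]→L[ℝ] ℂ) := typeProjL p 0 with hP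
  set L : ℝ := ∑ j ∈ Finset.range (N + 1), ((j : ℝ) / κ) ^ j + 1 with hL
  have hL1 : 1 ≤ L := by
    have : 0 ≤ ∑ j ∈ Finset.range (N + 1), ((j : ℝ) / κ) ^ j :=
      Finset.sum_nonneg fun j _ => by positivity
    linarith
  have hL0 : 0 < L := one_pos.trans_le hL1
  set η : ℝ := ε / (L * (‖P‖ + 1)) with hη
  have hη0 : 0 < η := by positivity
  obtain ⟨g, hg, hga⟩ := happrox η hη0
  refine ⟨g, hg, fun j hj x hx => ?_⟩
  set w : (ι → ℂ) → (ι → ℂ) [⋀^Fin n]→L[ℝ] ℂ := fun y => δ y - g y with hw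
  have hwu : (fun y => δ y - typeProjAt p 0 (g y)) = P ∘ w := by
    funext y
    simp only [hw, Function.comp_apply, hP, map_sub, typeProjL_apply, hδt]
  have hwd : DifferentiableOn ℂ w W := hδ.sub hg.differentiableOn
  have hballW : closedBall x κ ⊆ W := fun y hy => (hballs x hx hy).1
  have hwM : ∀ z ∈ closedBall x κ, ‖w z‖ ≤ η := fun z hz => hga z (hballs x hx hz).2
  have hxW : x ∈ W := hballW (mem_closedBall_self hκ.le)
  have hwC : ContDiffAt ℝ N w x :=
    (((SCV.contDiffOn_infty hwd hW).of_le (by exact_mod_cast le_top)).contDiffAt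
      (hW.mem_nhds hxW)).restrict_scalars ℝ
  have hjw : ‖iteratedFDeriv ℝ j w x‖ ≤ η * L := by
    rcases Nat.eq_zero_or_pos j with rfl | hjp
    · rw [norm_iteratedFDeriv_zero]
      calc ‖w x‖ ≤ η := hwM x (mem_closedBall_self hκ.le)
        _ = η * 1 := (mul_one η).symm
        _ ≤ η * L := by gcongr
    · calc ‖iteratedFDeriv ℝ j w x‖ ≤ η / (κ / j) ^ j :=
            norm_iteratedFDeriv_real_le_of_closedBall hwd hW hκ hballW hwM hjp
        _ = η * ((j : ℝ) / κ) ^ j := by rw [div_eq_mul_inv, ← inv_pow, inv_div]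
        _ ≤ η * L := by
            gcongr
            have hmem : j ∈ Finset.range (N + 1) := Finset.mem_range.2 (Nat.lt_succ_of_le hj)
            calc ((j : ℝ) / κ) ^ j ≤ ∑ j ∈ Finset.range (N + 1), ((j : ℝ) / κ) ^ j :=
                  Finset.single_le_sum (f := fun j : ℕ => ((j : ℝ) / κ) ^ j)
                    (fun i _ => by positivity) hmem
              _ ≤ L := by linarith
  rw [hwu]
  calc ‖iteratedFDeriv ℝ j (P ∘ w) x‖
      = ‖iteratedFDeriv ℝ j ((P.restrictScalars ℝ) ∘ w) x‖ := rfl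
    _ ≤ ‖P.restrictScalars ℝ‖ * ‖iteratedFDeriv ℝ j w x‖ :=
        (P.restrictScalars ℝ).norm_iteratedFDeriv_comp_left hwC (by exact_mod_cast hj)
    _ ≤ (‖P‖ + 1) * (η * L) := by
        gcongr
        exact (P.norm_restrictScalars (𝕜' := ℝ)).le.trans (le_add_of_nonneg_right zero_le_one)
    _ = ε := by rw [hη]; field_simp

/-! ### A complex cut-off between a compact set and an open neighbourhood -/

omit [DecidableEq ι] in
/-- A `C^∞` complex-valued cut-off equal to `1` on an open neighbourhood of a compact `K`, with
(topological) support inside the compact `K' ⊇ interior K' ⊇ K`. [folklore] -/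
theorem exists_complex_cutoff_of_isCompact {K K' : Set (ι → ℂ)} (hK : IsCompact K)
    (hK' : IsCompact K') (hKK' : K ⊆ interior K') :
    ∃ χ : (ι → ℂ) → ℂ, ContDiff ℝ ∞ χ ∧ HasCompactSupport χ ∧ tsupport χ ⊆ K' ∧
      ∃ N : Set (ι → ℂ), IsOpen N ∧ K ⊆ N ∧ N ⊆ interior K' ∧ ∀ x ∈ N, χ x = 1 := by
  obtain ⟨ψ, hψ, h1, h0⟩ :=
    Literature.Geometry.Kaehler.exists_contDiff_one_nhdsSet_of_isCompact hK isOpen_interior hKK'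
  obtain ⟨N₁, hN₁, hKN₁, hψ1⟩ := eventually_nhdsSet_iff_exists.1 h1
  obtain ⟨N₀, hN₀, hcN₀, hψ0⟩ := eventually_nhdsSet_iff_exists.1 h0
  set χ : (ι → ℂ) → ℂ := fun x => (ψ x : ℂ) with hχ
  have hsupp : Function.support χ ⊆ interior K' := by
    intro x hx
    by_contra hxK
    exact hx (by rw [hχ]; simp [hψ0 x (hcN₀ hxK)])
  have htsupp : tsupport χ ⊆ K' :=
    (closure_mono hsupp).trans ((closure_mono interior_subset).trans hK'.isClosed.closure_subset)
  refine ⟨χ, ?_, ?_, htsupp, N₁ ∩ interior K', hN₁.inter isOpen_interior,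
    subset_inter hKN₁ hKK', inter_subset_right, fun x hx => ?_⟩
  · exact ofRealCLM.contDiff.comp hψ
  · exact IsCompact.of_isClosed_subset hK' (isClosed_tsupport χ) htsupp
  · simp [hχ, hψ1 x hx.1]

/-! ### Data of type `(p,q+2)` (Hörmander's case `q > 0`) -/

/-- **`∂̄`-potentials on an open set exhausted by compacts with the Cousin property, data of type
`(p,q+2)`** (Hörmander (1973), Thm. 2.7.8, case `q > 0`). Let `Ω ⊆ ℂ^ι` be open, `K_j ⊆ Ω` with
`K_j ⊆ interior K_{j+1}` and `Ω ⊆ ⋃ K_j`, and assume the Cousin property of every `K_j` (`hC`: for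
`C^∞` data `f` of type `(p,q+1)` with `(df)^{p,q+2} = 0` on an open `W ⊇ K_j` there is a global
`C^∞` form `u`, fixed by the `(p,q)`-projection, with `(du)^{p,q+1} = f` on a neighbourhood of
`K_j`). Then every `α`, `C^∞` on `Ω`, of type `(p,q+2)` on `Ω` with `(dα)^{p,q+3} = 0` on `Ω`, is
`(dβ)^{p,q+2}` on `Ω` for some `β`, `C^∞` on `Ω` and fixed by the `(p,q+1)`-projection. Proof
(loc. cit.): potentials `u_j` near `K_j`; `u_j - u` is `∂̄`-closed near `K_j`, hence `= ∂̄v` near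
`K_j` (Cousin property one bidegree down), and `u + ∂̄v` solves near `K_{j+1}` and agrees with `u_j`
near `K_j`; the eventually constant sequence converges to the potential.
[cite: HormanderSCV1973, Thm. 2.7.8] -/
theorem exists_dbar_potential_of_compactExhaustion_succ {Ω : Set (ι → ℂ)} (hΩ : IsOpen Ω)
    {K : ℕ → Set (ι → ℂ)} (hKΩ : ∀ j, K j ⊆ Ω) (hKmono : ∀ j, K j ⊆ interior (K (j + 1)))
    (hΩK : Ω ⊆ ⋃ j, K j)
    (hC : ∀ (j : ℕ) {n p q : ℕ} {W : Set (ι → ℂ)}, IsOpen W → K j ⊆ W →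
      ∀ {f : (ι → ℂ) → (ι → ℂ) [⋀^Fin (n + 1)]→L[ℝ] ℂ}, ContDiffOn ℝ ∞ f W →
        (∀ x ∈ W, IsOfTypeAt p (q + 1) (f x)) →
        (∀ x ∈ W, typeProjAt p (q + 2) (extDeriv f x) = 0) →
        ∃ u : (ι → ℂ) → (ι → ℂ) [⋀^Fin n]→L[ℝ] ℂ, ContDiff ℝ ∞ u ∧
          (∀ x, typeProjAt p q (u x) = u x) ∧
          ∀ᶠ x in 𝓝ˢ (K j), typeProjAt p (q + 1) (extDeriv u x) = f x)
    {n p q : ℕ} {α : (ι → ℂ) → (ι → ℂ) [⋀^Fin (n + 1)]→L[ℝ] ℂ} (hα : ContDiffOn ℝ ∞ α Ω)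
    (htype : ∀ x ∈ Ω, IsOfTypeAt p (q + 2) (α x))
    (hclosed : ∀ x ∈ Ω, typeProjAt p (q + 3) (extDeriv α x) = 0) :
    ∃ β : (ι → ℂ) → (ι → ℂ) [⋀^Fin n]→L[ℝ] ℂ, ContDiffOn ℝ ∞ β Ω ∧
      (∀ x, typeProjAt p (q + 1) (β x) = β x) ∧
      ∀ x ∈ Ω, typeProjAt p (q + 2) (extDeriv β x) = α x := by
  classical
  by_cases hne : Ω.Nonempty
  swap
  · exact ⟨0, contDiffOn_const, fun x => by simp, fun x hx => absurd ⟨x, hx⟩ hne⟩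
  obtain ⟨x₀, hx₀⟩ := hne
  have hpqn : p + (q + 2) = n + 1 := (htype x₀ hx₀).1
  cases n with
  | zero => omega
  | succ n =>
  have hKle : ∀ {j j' : ℕ}, j ≤ j' → K j ⊆ K j' := by
    intro j j' h
    induction h with
    | refl => exact Subset.rfl
    | step _ ih => exact ih.trans ((hKmono _).trans interior_subset)
  -- potentials near the `K j`
  have hex : ∀ j, ∃ B : (ι → ℂ) → (ι → ℂ) [⋀^Fin (n + 1)]→L[ℝ] ℂ, ContDiff ℝ ∞ B ∧
      (∀ x, typeProjAt p (q + 1) (B x) = B x) ∧ ∃ O : Set (ι → ℂ), IsOpen O ∧ K j ⊆ O ∧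
        ∀ x ∈ O, typeProjAt p (q + 2) (extDeriv B x) = α x := by
    intro j
    obtain ⟨B, hB1, hB2, hB3⟩ := hC j hΩ (hKΩ j) hα htype hclosed
    obtain ⟨O, hO, hKO, hBO⟩ := eventually_nhdsSet_iff_exists.1 hB3
    exact ⟨B, hB1, hB2, O, hO, hKO, hBO⟩
  choose B hB₁ hB₂ O hO hKO hB₃ using hex
  -- the invariant of the corrected sequence and the correction step
  let Inv : ℕ → ((ι → ℂ) → (ι → ℂ) [⋀^Fin (n + 1)]→L[ℝ] ℂ) → Prop := fun j β =>
    ContDiff ℝ ∞ β ∧ (∀ x, typeProjAt p (q + 1) (β x) = β x) ∧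
      ∃ O' : Set (ι → ℂ), IsOpen O' ∧ K (j + 1) ⊆ O' ∧
        ∀ x ∈ O', typeProjAt p (q + 2) (extDeriv β x) = α x
  have corr : ∀ j β, Inv j β → ∃ β', Inv (j + 1) β' ∧ ∀ x ∈ K (j + 1), β' x = β x := by
    rintro j β ⟨hβ₁, hβ₂, O₁, hO₁, hKO₁, hβ₃⟩
    set δ : (ι → ℂ) → (ι → ℂ) [⋀^Fin (n + 1)]→L[ℝ] ℂ := fun x => B (j + 2) x - β x with hδ
    have hδs : ContDiff ℝ ∞ δ := (hB₁ (j + 2)).sub hβ₁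
    have hδt : ∀ x, IsOfTypeAt p (q + 1) (δ x) := fun x =>
      (isOfTypeAt_iff_typeProjAt_eq_self (by omega) _).2
        (by simp only [hδ, typeProjAt_sub, hB₂, hβ₂])
    set W : Set (ι → ℂ) := O₁ ∩ O (j + 2) with hW
    have hWo : IsOpen W := hO₁.inter (hO _)
    have hKW : K (j + 1) ⊆ W := subset_inter hKO₁ ((hKle (Nat.le_succ _)).trans (hKO (j + 2)))
    have hδc : ∀ x ∈ W, typeProjAt p (q + 2) (extDeriv δ x) = 0 := by
      intro x hx
      rw [hδ, extDeriv_sub_apply (((hB₁ (j + 2)).differentiable (by simp)).differentiableAt)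
        ((hβ₁.differentiable (by simp)).differentiableAt), typeProjAt_sub, hB₃ (j + 2) x hx.2,
        hβ₃ x hx.1, sub_self]
    obtain ⟨γ, hγ₁, hγ₂, hγ₃⟩ :=
      hC (j + 1) (n := n) (p := p) (q := q) hWo hKW hδs.contDiffOn (fun x _ => hδt x) hδc
    obtain ⟨O₂, hO₂, hKO₂, hγO₂⟩ := eventually_nhdsSet_iff_exists.1 hγ₃
    have hγt : ∀ y, IsOfTypeAt p q (γ y) := fun y =>
      (isOfTypeAt_iff_typeProjAt_eq_self (by omega) _).2 (hγ₂ y)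
    refine ⟨fun x => B (j + 2) x - typeProjAt p (q + 1) (extDeriv γ x),
      ⟨?_, ?_, O (j + 2), hO _, hKO _, ?_⟩, ?_⟩
    · exact (hB₁ (j + 2)).sub (contDiff_typeProjAt_extDeriv p (q + 1) hγ₁)
    · intro x
      simp only [typeProjAt_sub, hB₂, typeProjAt_typeProjAt_self]
    · intro x hx
      rw [extDeriv_sub_apply (((hB₁ (j + 2)).differentiable (by simp)).differentiableAt)
        (((contDiff_typeProjAt_extDeriv p (q + 1) hγ₁).differentiable (by simp)).differentiableAt),
        typeProjAt_sub, hB₃ (j + 2) x hx, dbar_dbar_eq_zero hγt hγ₁ x, sub_zero]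
    · intro x hx
      simp only [hγO₂ x (hKO₂ hx), hδ, sub_sub_cancel]
  -- the corrected sequence
  have inv0 : Inv 0 (B 1) := ⟨hB₁ 1, hB₂ 1, O 1, hO 1, hKO 1, hB₃ 1⟩
  let S : ∀ j : ℕ, {β // Inv j β} := fun j =>
    Nat.rec (motive := fun j => {β // Inv j β}) ⟨B 1, inv0⟩
      (fun j s => ⟨Classical.choose (corr j s.1 s.2), (Classical.choose_spec (corr j s.1 s.2)).1⟩) j
  have hS : ∀ j, ∀ x ∈ K (j + 1), (S (j + 1)).1 x = (S j).1 x := fun j =>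
    (Classical.choose_spec (corr j (S j).1 (S j).2)).2
  have hS' : ∀ j i, ∀ x ∈ K (j + 1), (S (j + i)).1 x = (S j).1 x := by
    intro j i x hx
    induction i with
    | zero => rfl
    | succ i ih =>
      rw [← ih, ← add_assoc]
      exact hS (j + i) x (hKle (by omega) hx)
  -- its eventual value
  let β : (ι → ℂ) → (ι → ℂ) [⋀^Fin (n + 1)]→L[ℝ] ℂ := fun x =>
    if h : ∃ j, x ∈ K (j + 1) then (S (Nat.find h)).1 x else 0
  have hβS : ∀ j, ∀ x ∈ K (j + 1), β x = (S j).1 x := by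
    intro j x hx
    have h : ∃ j, x ∈ K (j + 1) := ⟨j, hx⟩
    simp only [β, dif_pos h]
    have hk : Nat.find h ≤ j := Nat.find_min' h hx
    obtain ⟨i, rfl⟩ := Nat.exists_eq_add_of_le hk
    exact (hS' _ i x (Nat.find_spec h)).symm
  have hβev : ∀ j, ∀ x ∈ K (j + 1), β =ᶠ[𝓝 x] (S (j + 1)).1 := fun j x hx =>
    Filter.eventuallyEq_of_mem (isOpen_interior.mem_nhds (hKmono (j + 1) hx))
      fun y hy => hβS (j + 1) y (interior_subset hy)
  have hmem : ∀ x ∈ Ω, ∃ j, x ∈ K (j + 1) := fun x hx => by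
    obtain ⟨j, hj⟩ := mem_iUnion.1 (hΩK hx)
    exact ⟨j, hKle (Nat.le_succ j) hj⟩
  refine ⟨β, fun x hx => ?_, fun x => ?_, fun x hx => ?_⟩
  · obtain ⟨j, hj⟩ := hmem x hx
    exact (((S (j + 1)).2.1.contDiffAt).congr_of_eventuallyEq (hβev j x hj)).contDiffWithinAt
  · simp only [β]
    split_ifs with h
    · exact (S (Nat.find h)).2.2.1 x
    · exact typeProjAt_zero p (q + 1)
  · obtain ⟨j, hj⟩ := hmem x hx
    rw [extDeriv_congr_of_eventuallyEq (hβev j x hj)]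
    obtain ⟨O', -, hKO', hO'⟩ := (S (j + 1)).2.2.2
    exact hO' x (hKO' (hKle (by omega) hj))

/-! ### Data of type `(p,1)` (Hörmander's case `q = 0`) -/

/-- **`∂̄`-potentials on an open set exhausted by compacts with the Cousin and approximation
properties, data of type `(p,1)`** (Hörmander (1973), Thm. 2.7.8, case `q = 0`). In the situation
of `exists_dbar_potential_of_compactExhaustion_succ` with compact `K_j`, assume moreover (`hA`,
Hörmander's Thm. 2.7.7 for the `K_j`) that every function holomorphic on an open neighbourhood of
`K_j` is a uniform limit on `K_j` of entire functions. Then every `α`, `C^∞` on `Ω`, of type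
`(p,1)` on `Ω` with `(dα)^{p,2} = 0` on `Ω`, is `(dβ)^{p,1}` on `Ω` for some `β`, `C^∞` on `Ω`, of
type `(p,0)`. Proof (loc. cit.): the differences `u_{j+1} - u_j` of the local potentials are
holomorphic near `K_j`, so by approximation the `u_j` can be chosen with all derivatives of order
`≤ j` of `u_{j+1} - u_j` bounded by `2^{-j}` on `K_j` (Cauchy estimates); `u = lim u_j` is `C^∞`
and `∂̄u = f` (the tail is a series of maps holomorphic near each point).
[cite: HormanderSCV1973, Thm. 2.7.8] -/
theorem exists_dbar_potential_of_compactExhaustion_zero {Ω : Set (ι → ℂ)} (hΩ : IsOpen Ω)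
    {K : ℕ → Set (ι → ℂ)} (hKc : ∀ j, IsCompact (K j)) (hKΩ : ∀ j, K j ⊆ Ω)
    (hKmono : ∀ j, K j ⊆ interior (K (j + 1))) (hΩK : Ω ⊆ ⋃ j, K j)
    (hC : ∀ (j : ℕ) {n p q : ℕ} {W : Set (ι → ℂ)}, IsOpen W → K j ⊆ W →
      ∀ {f : (ι → ℂ) → (ι → ℂ) [⋀^Fin (n + 1)]→L[ℝ] ℂ}, ContDiffOn ℝ ∞ f W →
        (∀ x ∈ W, IsOfTypeAt p (q + 1) (f x)) →
        (∀ x ∈ W, typeProjAt p (q + 2) (extDeriv f x) = 0) →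
        ∃ u : (ι → ℂ) → (ι → ℂ) [⋀^Fin n]→L[ℝ] ℂ, ContDiff ℝ ∞ u ∧
          (∀ x, typeProjAt p q (u x) = u x) ∧
          ∀ᶠ x in 𝓝ˢ (K j), typeProjAt p (q + 1) (extDeriv u x) = f x)
    (hA : ∀ (j : ℕ) {W : Set (ι → ℂ)}, IsOpen W → K j ⊆ W →
      ∀ {h : (ι → ℂ) → ℂ}, DifferentiableOn ℂ h W →
        ∀ ε > 0, ∃ g : (ι → ℂ) → ℂ, Differentiable ℂ g ∧ ∀ x ∈ K j, ‖h x - g x‖ ≤ ε)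
    {n p : ℕ} {α : (ι → ℂ) → (ι → ℂ) [⋀^Fin (n + 1)]→L[ℝ] ℂ} (hα : ContDiffOn ℝ ∞ α Ω)
    (htype : ∀ x ∈ Ω, IsOfTypeAt p 1 (α x))
    (hclosed : ∀ x ∈ Ω, typeProjAt p 2 (extDeriv α x) = 0) :
    ∃ β : (ι → ℂ) → (ι → ℂ) [⋀^Fin n]→L[ℝ] ℂ, ContDiffOn ℝ ∞ β Ω ∧
      (∀ x, typeProjAt p 0 (β x) = β x) ∧
      ∀ x ∈ Ω, typeProjAt p 1 (extDeriv β x) = α x := by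
  classical
  by_cases hne : Ω.Nonempty
  swap
  · exact ⟨0, contDiffOn_const, fun x => by simp, fun x hx => absurd ⟨x, hx⟩ hne⟩
  obtain ⟨x₀, hx₀⟩ := hne
  have hpn : p + 0 = n := by have := (htype x₀ hx₀).1; omega
  haveI : FiniteDimensional ℂ ((ι → ℂ) [⋀^Fin n]→L[ℝ] ℂ) := finiteDimensional_complex_forms n
  have hKle : ∀ {j j' : ℕ}, j ≤ j' → K j ⊆ K j' := by
    intro j j' h
    induction h with
    | refl => exact Subset.rfl
    | step _ ih => exact ih.trans ((hKmono _).trans interior_subset)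
  -- potentials near the `K j`
  have hex : ∀ j, ∃ B : (ι → ℂ) → (ι → ℂ) [⋀^Fin n]→L[ℝ] ℂ, ContDiff ℝ ∞ B ∧
      (∀ x, typeProjAt p 0 (B x) = B x) ∧ ∃ O : Set (ι → ℂ), IsOpen O ∧ K j ⊆ O ∧
        ∀ x ∈ O, typeProjAt p 1 (extDeriv B x) = α x := by
    intro j
    obtain ⟨B, hB1, hB2, hB3⟩ := hC j (q := 0) hΩ (hKΩ j) hα htype hclosed
    obtain ⟨O, hO, hKO, hBO⟩ := eventually_nhdsSet_iff_exists.1 hB3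
    exact ⟨B, hB1, hB2, O, hO, hKO, hBO⟩
  choose B hB₁ hB₂ O hO hKO hB₃ using hex
  -- gaps: closed `κ_j`-neighbourhoods of `K j` inside `interior (K (j+1))`
  have hκex : ∀ j, ∃ κ : ℝ, 0 < κ ∧ cthickening κ (K j) ⊆ interior (K (j + 1)) := fun j =>
    (hKc j).exists_cthickening_subset_open isOpen_interior (hKmono j)
  choose κ hκ0 hκK using hκex
  -- invariant, smallness, and the correction step
  let Inv : ℕ → ((ι → ℂ) → (ι → ℂ) [⋀^Fin n]→L[ℝ] ℂ) → Prop := fun j β =>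
    ContDiff ℝ ∞ β ∧ (∀ x, typeProjAt p 0 (β x) = β x) ∧
      ∃ O' : Set (ι → ℂ), IsOpen O' ∧ K (j + 1) ⊆ O' ∧
        ∀ x ∈ O', typeProjAt p 1 (extDeriv β x) = α x
  let Good : ℕ → ((ι → ℂ) → (ι → ℂ) [⋀^Fin n]→L[ℝ] ℂ) → Prop := fun j u =>
    (∃ O' : Set (ι → ℂ), IsOpen O' ∧ K (j + 1) ⊆ O' ∧ DifferentiableOn ℂ u O') ∧
      ∀ i ≤ j + 1, ∀ x ∈ K j, ‖iteratedFDeriv ℝ i u x‖ ≤ (1 / 2 : ℝ) ^ j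
  have corr : ∀ j β, Inv j β → ∃ β', Inv (j + 1) β' ∧ Good j (fun x => β' x - β x) := by
    rintro j β ⟨hβ₁, hβ₂, O₁, hO₁, hKO₁, hβ₃⟩
    -- `δ = B (j+2) - β` is a smooth `(p,0)`-form, `∂̄`-closed hence holomorphic near `K (j+1)`
    set δ : (ι → ℂ) → (ι → ℂ) [⋀^Fin n]→L[ℝ] ℂ := fun x => B (j + 2) x - β x with hδ
    have hδs : ContDiff ℝ ∞ δ := (hB₁ (j + 2)).sub hβ₁
    have hδf : ∀ x, typeProjAt p 0 (δ x) = δ x := fun x => by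
      simp only [hδ, typeProjAt_sub, hB₂, hβ₂]
    have hδt : ∀ x, IsOfTypeAt p 0 (δ x) := fun x =>
      (isOfTypeAt_iff_typeProjAt_eq_self hpn _).2 (hδf x)
    set W : Set (ι → ℂ) := O₁ ∩ O (j + 2) with hW
    have hWo : IsOpen W := hO₁.inter (hO _)
    have hKW : K (j + 1) ⊆ W := subset_inter hKO₁ ((hKle (Nat.le_succ _)).trans (hKO (j + 2)))
    have hδc : ∀ x ∈ W, typeProjAt p 1 (extDeriv δ x) = 0 := by
      intro x hx
      rw [hδ, extDeriv_sub_apply (((hB₁ (j + 2)).differentiable (by simp)).differentiableAt)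
        ((hβ₁.differentiable (by simp)).differentiableAt), typeProjAt_sub, hB₃ (j + 2) x hx.2,
        hβ₃ x hx.1, sub_self]
    have hδhol : DifferentiableOn ℂ δ W :=
      differentiableOn_complex_of_typeZero hWo ((hδs.differentiable (by simp)).differentiableOn)
        hδt hδc
    -- entire approximation on `K (j+1)`, to order `j + 1` within `(1/2)^j` on `K j`
    have happrox : ∀ ε > 0, ∃ g : (ι → ℂ) → (ι → ℂ) [⋀^Fin n]→L[ℝ] ℂ, Differentiable ℂ g ∧
        ∀ y ∈ K (j + 1), ‖δ y - g y‖ ≤ ε := fun ε hε =>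
      exists_entire_approx_of_scalar (fun hh => hA (j + 1) hWo hKW hh) hδhol hε
    have hballs : ∀ x ∈ K j, closedBall x (κ j) ⊆ W ∩ K (j + 1) := fun x hx =>
      ((closedBall_subset_cthickening hx (κ j)).trans (hκK j)).trans
        (subset_inter (interior_subset.trans hKW) interior_subset)
    obtain ⟨g, hg, hgb⟩ := exists_entire_correction_of_approx hWo hδhol hδf (hκ0 j) hballs happrox
      (j + 1) (pow_pos (by norm_num : (0 : ℝ) < 1 / 2) j)
    obtain ⟨hPs, hPt, hPc⟩ := entire_typeProj_aux (ι := ι) hpn hg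
    refine ⟨fun x => B (j + 2) x - typeProjAt p 0 (g x), ⟨?_, ?_, O (j + 2), hO _, hKO _, ?_⟩,
      ⟨W, hWo, hKW, ?_⟩, ?_⟩
    · exact (hB₁ (j + 2)).sub hPs
    · intro x
      simp only [typeProjAt_sub, hB₂, typeProjAt_typeProjAt_self]
    · intro x hx
      rw [extDeriv_sub_apply (((hB₁ (j + 2)).differentiable (by simp)).differentiableAt)
        ((hPs.differentiable (by simp)).differentiableAt), typeProjAt_sub, hB₃ (j + 2) x hx, hPc x,
        sub_zero]
    · have : (fun x => B (j + 2) x - typeProjAt p 0 (g x) - β x) =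
          fun x => δ x - typeProjAt p 0 (g x) := by
        funext x; simp only [hδ]; abel
      rw [this]
      exact hδhol.sub ((((typeProjL (E := ι → ℂ) (k := n) p 0).differentiable).comp hg).differentiableOn)
    · intro i hi x hx
      have : (fun x => B (j + 2) x - typeProjAt p 0 (g x) - β x) =
          fun x => δ x - typeProjAt p 0 (g x) := by
        funext x; simp only [hδ]; abel
      rw [this]
      exact hgb i hi x hx
  -- the corrected sequence and its increments
  have inv0 : Inv 0 (B 1) := ⟨hB₁ 1, hB₂ 1, O 1, hO 1, hKO 1, hB₃ 1⟩
  let S : ∀ j : ℕ, {β // Inv j β} := fun j =>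
    Nat.rec (motive := fun j => {β // Inv j β}) ⟨B 1, inv0⟩
      (fun j s => ⟨Classical.choose (corr j s.1 s.2), (Classical.choose_spec (corr j s.1 s.2)).1⟩) j
  set u : ℕ → (ι → ℂ) → (ι → ℂ) [⋀^Fin n]→L[ℝ] ℂ := fun j x => (S (j + 1)).1 x - (S j).1 x with hu
  have hGood : ∀ j, Good j (u j) := fun j =>
    (Classical.choose_spec (corr j (S j).1 (S j).2)).2
  have hus : ∀ j, ContDiff ℝ ∞ (u j) := fun j => (S (j + 1)).2.1.sub (S j).2.1
  have huf : ∀ j x, typeProjAt p 0 (u j x) = u j x := fun j x => by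
    simp only [hu, typeProjAt_sub, (S (j + 1)).2.2.1, (S j).2.2.1]
  have tele : ∀ k x, (S k).1 x = (S 0).1 x + ∑ j ∈ Finset.range k, u j x := by
    intro k x
    induction k with
    | zero => simp
    | succ k ih => rw [Finset.sum_range_succ, ← add_assoc, ← ih]; simp only [hu]; abel
  -- the potential: the pointwise limit
  let β : (ι → ℂ) → (ι → ℂ) [⋀^Fin n]→L[ℝ] ℂ := fun x => (S 0).1 x + ∑' j, u j x
  have hβf : ∀ x, typeProjAt p 0 (β x) = β x := by
    intro x
    simp only [β]
    rw [typeProjAt_add, (S 0).2.2.1]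
    congr 1
    by_cases hsx : Summable fun j => u j x
    · rw [← typeProjL_apply, (typeProjL (E := ι → ℂ) (k := n) p 0).map_tsum hsx]
      simp only [typeProjL_apply, huf]
    · rw [tsum_eq_zero_of_not_summable hsx, typeProjAt_zero]
  -- local structure near `K k`: `β = S (k+1) + T_k` with `T_k` a smooth cut-off series
  have local_repr : ∀ k, ∃ T : (ι → ℂ) → (ι → ℂ) [⋀^Fin n]→L[ℝ] ℂ, ContDiff ℝ ∞ T ∧
      ∃ N : Set (ι → ℂ), IsOpen N ∧ K k ⊆ N ∧
        (∀ x ∈ N, β x = (S (k + 1)).1 x + T x) ∧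
        ∀ x ∈ N, typeProjAt p 1 (extDeriv T x) = 0 := by
    intro k
    obtain ⟨χ, hχ, hχc, hχsupp, N, hN, hKN, hNint, hχ1⟩ :=
      exists_complex_cutoff_of_isCompact (hKc k) (hKc (k + 1)) (hKmono k)
    -- the shifted family and its bounds on `K (k+1)`
    set v : ℕ → (ι → ℂ) → (ι → ℂ) [⋀^Fin n]→L[ℝ] ℂ := fun m => u (m + (k + 1)) with hv
    have hvb : ∀ m, ∀ i ≤ m + 1, ∀ x ∈ K (k + 1),
        ‖iteratedFDeriv ℝ i (v m) x‖ ≤ (1 / 2 : ℝ) ^ (m + (k + 1)) := by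
      intro m i hi x hx
      exact (hGood (m + (k + 1))).2 i (by omega) x (hKle (by omega) hx)
    have ha : Summable fun m : ℕ => (1 / 2 : ℝ) ^ (m + (k + 1)) := by
      simp_rw [pow_add]
      exact (summable_geometric_of_lt_one (by norm_num) (by norm_num)).mul_right _
    obtain ⟨hT, hT0, hT1, hTd⟩ := contDiff_tsum_smul_cutoff (fun m => hus (m + (k + 1))) hχ hχc
      hχsupp ha (fun m => by positivity) hvb
    refine ⟨fun x => ∑' m, χ x • v m x, hT, N, hN, hKN, fun x hx => ?_, fun x hx => ?_⟩
    · -- on `N`: `χ = 1`, the series of `u` converges, reindex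
      have hx1 : χ x = 1 := hχ1 x hx
      have hxK : x ∈ K (k + 1) := interior_subset (hNint hx)
      have hsum : Summable fun j => u j x := by
        refine Summable.of_norm_bounded_eventually_nat
          (summable_geometric_of_lt_one (by norm_num : (0:ℝ) ≤ 1 / 2) (by norm_num)) ?_
        rw [eventually_atTop]
        refine ⟨k + 1, fun m hm => ?_⟩
        have h0 := (hGood m).2 0 (Nat.zero_le _) x (hKle hm hxK)
        rwa [norm_iteratedFDeriv_zero] at h0
      simp only [β, hx1, one_smul, hv]
      rw [tele (k + 1) x, add_assoc, hsum.sum_add_tsum_nat_add (k + 1)]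
    · -- `∂̄ T = 0` on `N`: the derivative is the sum of derivatives of maps holomorphic at `x`
      have hxK : x ∈ K (k + 1) := interior_subset (hNint hx)
      have hTt : ∀ y, IsOfTypeAt p 0 (∑' m, χ y • v m y) := by
        intro y
        refine (isOfTypeAt_iff_typeProjAt_eq_self hpn _).2 ?_
        rw [← typeProjL_apply, (typeProjL (E := ι → ℂ) (k := n) p 0).map_tsum (hT0 y)]
        simp only [map_smul, typeProjL_apply, hv, huf]
      rw [typeProjAt_extDeriv_eq_sum hTt]
      refine Finset.sum_eq_zero fun j _ => ?_
      rw [dbarAlong_eq_zero_of_hasFDerivAt_tsum (hT1 x) (hTd x) (fun m w => ?_), wedgeOne_zero]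
      -- each `χ • v m` agrees with the holomorphic `v m` near `x`
      obtain ⟨O', hO', hKO', hhol⟩ := (hGood (m + (k + 1))).1
      have hxO' : x ∈ O' := hKO' (hKle (by omega) hxK)
      have hholx : DifferentiableAt ℂ (v m) x := hhol.differentiableAt (hO'.mem_nhds hxO')
      have hev : (fun y => χ y • v m y) =ᶠ[𝓝 x] v m := by
        filter_upwards [hN.mem_nhds hx] with y hy
        rw [hχ1 y hy, one_smul]
      have hholχ : DifferentiableAt ℂ (fun y => χ y • v m y) x := hholx.congr_of_eventuallyEq hev
      rw [hholχ.fderiv_restrictScalars ℝ]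
      simp
  refine ⟨β, fun x hx => ?_, hβf, fun x hx => ?_⟩
  · -- smoothness on `Ω`
    obtain ⟨k, hk⟩ := mem_iUnion.1 (hΩK hx)
    obtain ⟨T, hT, N, hN, hKN, hβT, -⟩ := local_repr k
    have hev : β =ᶠ[𝓝 x] fun y => (S (k + 1)).1 y + T y :=
      Filter.eventuallyEq_of_mem (hN.mem_nhds (hKN hk)) hβT
    exact ((((S (k + 1)).2.1.add hT).contDiffAt).congr_of_eventuallyEq hev).contDiffWithinAt
  · -- the equation on `Ω`
    obtain ⟨k, hk⟩ := mem_iUnion.1 (hΩK hx)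
    obtain ⟨T, hT, N, hN, hKN, hβT, hTc⟩ := local_repr k
    have hev : β =ᶠ[𝓝 x] fun y => (S (k + 1)).1 y + T y :=
      Filter.eventuallyEq_of_mem (hN.mem_nhds (hKN hk)) hβT
    obtain ⟨O', -, hKO', hO'⟩ := (S (k + 1)).2.2.2
    rw [hev.extDeriv_eq, show (fun y => (S (k + 1)).1 y + T y) = (S (k + 1)).1 + T from rfl,
      extDeriv_add (((S (k + 1)).2.1.differentiable (by simp)).differentiableAt)
      ((hT.differentiable (by simp)).differentiableAt), typeProjAt_add,
      hO' x (hKO' (hKle (by omega) hk)), hTc x (hKN hk), add_zero]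

/-! ### Both cases; the flat-solver format -/

/-- **`∂̄`-potentials on an open set exhausted by compacts with the Cousin and approximation
properties, all bidegrees `(p,q+1)`** (Hörmander (1973), Thm. 2.7.8: `∂̄u = f` is solvable in
`C^∞_{(p,q)}(Ω)` for every `∂̄`-closed `f ∈ C^∞_{(p,q+1)}(Ω)`, for `Ω` exhausted by compacts with
the Cousin property and — for `q = 0` — the entire-approximation property).
[cite: HormanderSCV1973, Thm. 2.7.8] -/
theorem exists_dbar_potential_of_compactExhaustion {Ω : Set (ι → ℂ)} (hΩ : IsOpen Ω)
    {K : ℕ → Set (ι → ℂ)} (hKc : ∀ j, IsCompact (K j)) (hKΩ : ∀ j, K j ⊆ Ω)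
    (hKmono : ∀ j, K j ⊆ interior (K (j + 1))) (hΩK : Ω ⊆ ⋃ j, K j)
    (hC : ∀ (j : ℕ) {n p q : ℕ} {W : Set (ι → ℂ)}, IsOpen W → K j ⊆ W →
      ∀ {f : (ι → ℂ) → (ι → ℂ) [⋀^Fin (n + 1)]→L[ℝ] ℂ}, ContDiffOn ℝ ∞ f W →
        (∀ x ∈ W, IsOfTypeAt p (q + 1) (f x)) →
        (∀ x ∈ W, typeProjAt p (q + 2) (extDeriv f x) = 0) →
        ∃ u : (ι → ℂ) → (ι → ℂ) [⋀^Fin n]→L[ℝ] ℂ, ContDiff ℝ ∞ u ∧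
          (∀ x, typeProjAt p q (u x) = u x) ∧
          ∀ᶠ x in 𝓝ˢ (K j), typeProjAt p (q + 1) (extDeriv u x) = f x)
    (hA : ∀ (j : ℕ) {W : Set (ι → ℂ)}, IsOpen W → K j ⊆ W →
      ∀ {h : (ι → ℂ) → ℂ}, DifferentiableOn ℂ h W →
        ∀ ε > 0, ∃ g : (ι → ℂ) → ℂ, Differentiable ℂ g ∧ ∀ x ∈ K j, ‖h x - g x‖ ≤ ε)
    {n p q : ℕ} {α : (ι → ℂ) → (ι → ℂ) [⋀^Fin (n + 1)]→L[ℝ] ℂ} (hα : ContDiffOn ℝ ∞ α Ω)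
    (htype : ∀ x ∈ Ω, IsOfTypeAt p (q + 1) (α x))
    (hclosed : ∀ x ∈ Ω, typeProjAt p (q + 2) (extDeriv α x) = 0) :
    ∃ β : (ι → ℂ) → (ι → ℂ) [⋀^Fin n]→L[ℝ] ℂ, ContDiffOn ℝ ∞ β Ω ∧
      (∀ x, typeProjAt p q (β x) = β x) ∧
      ∀ x ∈ Ω, typeProjAt p (q + 1) (extDeriv β x) = α x := by
  cases q with
  | zero =>
    have htype' : ∀ x ∈ Ω, IsOfTypeAt p 1 (α x) := htype
    have hclosed' : ∀ x ∈ Ω, typeProjAt p 2 (extDeriv α x) = 0 := hclosed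
    obtain ⟨β, h1, h2, h3⟩ := exists_dbar_potential_of_compactExhaustion_zero (p := p) hΩ hKc hKΩ
      hKmono hΩK hC hA hα htype' hclosed'
    exact ⟨β, h1, h2, h3⟩
  | succ q =>
    exact exists_dbar_potential_of_compactExhaustion_succ (p := p) (q := q) hΩ hKΩ hKmono hΩK hC hα
      htype hclosed

end Literature.Analysis.Complex
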